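import Literature.NumberTheory.EllipticCurves.KubotaLeopoldtTwoNumerator
import Literature.NumberTheory.EllipticCurves.PAdicLFunctionInterpolationHoldsProofs
import Literature.NumberTheory.EllipticCurves.PAdicLFunctionIntegralityAtTwoProofs
import Literature.NumberTheory.EllipticCurves.PAdicLFunctionDistributionProofs
import Summits.BirchSwinnertonDyer.Rank1Residual.X1.MuLambdaAlgebra
import Summits.BirchSwinnertonDyer.BirchSwinnertonDyer.Theorems.TwoAdicConverseFullTwoTorsionRamifiedUnique
import HarnessLib

/-!
# Route `EisensteinDepletionAtTwo`, crux E1M `DepletedLambdaLawAtTwoMod` (item stmt-BirchSwinnertonDyer-20341), line `star` —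
# Λ-GLUE LEMMAS for the first split of (★): primitive-scale transfer, the two `η`-halves of the 2-adic Riemann sums,
# `‖C(2ⁿ,k+1)‖₂ → 0`, units of `ℤ₂` are `≡ 1 (mod 2)` (part 1 of 2; part 2 is `…StarGlue.lean`)

Cell `bsd-rank2` (HOME run/shared/lean/pub/bsd-rank2/), seat `bsd-rank2-star-p1` (lead of line `star`). THEOREMS ONLY — no
definition, no named fact, no `sorry`. HONEST FRAMING: `Λ`-bookkeeping and elementary 2-adic estimates serving the lead's stub
`stub_starGlue : StarSymbC → StarEisNorm → StarCoreAtTwo` of `Cruxes/DepletedLambdaLawAtTwoMod/Lines/star.lean` v2; nothing here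
reads an analytic rank and BSD is not proved by any of this (PARTITION D-0054: none — r_an ≥ 2 axis S0, door T-r3₂).
`Λ = ℤ_p⟦T⟧`, `ι : Λ → ℚ_p⟦T⟧`, `red : Λ → 𝔽_p⟦T⟧`, `pfree` the `p`-free part (`X1.MuLambda`).

* §1 — coefficientwise congruence mod `𝔪` ⇒ equal reductions (`red_eq_red_of_norm_coeff_sub_lt_one`); the PRIMITIVE-SCALE
  TRANSFER `exists_units_pfree_eq_C_mul`: two rational multiples `L₀ ≠ 0`, `L₁` in `Λ` of one power series with `red L₁ ≠ 0`
  satisfy `pfree L₀ = u·L₁`, `u ∈ ℤ_p^×`; at `p = 2` literally `red(pfree L₀) = red L₁` (`red_pfree_eq_red_two`, `𝔽₂^× = {1}`).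
* §2 — at `p = 2` the Mazur–Tate–Teitelbaum Riemann sums of any set function split into the two `η`-halves `a ≡ ±5ˢ`
  (`distributionRiemannSum_two_eq_add`; `ℤ₂^× = {±1}·(1+4ℤ₂)`, `γ = 5`), with `5ˢ ≡ 1` and `−5ˢ ≡ 3 (mod 4)`.
* §3 — `Σ_{s<N} C(s,k) = C(N,k+1)`, `‖C(2ⁿ,k+1)‖₂ ≤ 2⁻ⁿ/‖k+1‖₂` (from `(k+1)C(2ⁿ,k+1) = 2ⁿC(2ⁿ−1,k)`), `‖w − 1‖₂ ≤ 1/2`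
  for `w ∈ ℤ₂^×`, in particular for the inverse powers of the unit root `α_W` at a good ordinary `2`.

References: B. Mazur, J. Tate, J. Teitelbaum, Invent. Math. 84 (1986), §I.10–I.13 [MazurTateTeitelbaum1986Invent];
L. Washington, GTM 83, §7.1 [Washington1997].
-/

set_option linter.dupNamespace false
set_option autoImplicit false

noncomputable section

open scoped Classical
open scoped MatrixGroups

open Filter Topology CongruenceSubgroup
  Literature.NumberTheory.EllipticCurves Literature.NumberTheory.EllipticCurves.ModularForms
  Summit.BirchSwinnertonDyer.Rank1Residual.X1.MuLambda

namespace Summit.BirchSwinnertonDyer.BirchSwinnertonDyer.Theorems.DepletionAtTwo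

/-! ## §1. Three `Λ`-lemmas: reductions from coefficient congruences; the primitive-scale transfer -/

section Lambda

variable {p : ℕ} [Fact p.Prime]

/-- Two elements of `Λ = ℤ_p⟦T⟧` whose coefficients are congruent modulo `𝔪 = pℤ_p` have the same reduction in `𝔽_p⟦T⟧`.
[cite: Washington1997, §7.1] -/
theorem red_eq_red_of_norm_coeff_sub_lt_one {A B : IwasawaAlgebra p}
    (h : ∀ k : ℕ, ‖PowerSeries.coeff k A - PowerSeries.coeff k B‖ < 1) : red A = red B := by
  ext k
  simp only [red, PowerSeries.coeff_map]
  exact (Ideal.Quotient.eq).mpr ((IsLocalRing.mem_maximalIdeal _).mpr (PadicInt.mem_nonunits.mpr (h k)))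

/-- If `red L ≠ 0` then some coefficient of `L` is a unit of `ℤ_p`. [cite: Washington1997, §7.1] -/
theorem exists_isUnit_coeff_of_red_ne_zero {L : IwasawaAlgebra p} (h : red L ≠ 0) :
    ∃ k : ℕ, IsUnit (PowerSeries.coeff k L) := by
  by_contra hcon
  push Not at hcon
  apply h
  ext k
  simp only [red, PowerSeries.coeff_map, map_zero]
  have hk : PowerSeries.coeff k L ∈ IsLocalRing.maximalIdeal ℤ_[p] :=
    (IsLocalRing.mem_maximalIdeal _).mpr (mem_nonunits_iff.mpr (hcon k))
  exact (IsLocalRing.residue_eq_zero_iff _).mpr hk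

/-- **Primitive-scale transfer.** If `L₀ ≠ 0` and `L₁` in `Λ` are rational multiples of the same power series `X ∈ ℚ_p⟦T⟧`
(`ι L₀ = c·X`, `ι L₁ = c'·X`) and `L₁` has unit content (`red L₁ ≠ 0`), then the `p`-free part of `L₀` is a UNIT CONSTANT multiple
of `L₁`: `pfree L₀ = u·L₁`, `u ∈ ℤ_p^×`. [cite: Washington1997, §7.1] -/
theorem exists_units_pfree_eq_C_mul {L₀ L₁ : IwasawaAlgebra p} {c c' : ℚ_[p]} {X : PowerSeries ℚ_[p]}
    (h₀ : L₀ ≠ 0) (hι₀ : iwasawaToPowerSeries p L₀ = PowerSeries.C c * X)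
    (hι₁ : iwasawaToPowerSeries p L₁ = PowerSeries.C c' * X) (h₁ : red L₁ ≠ 0) :
    ∃ u : ℤ_[p]ˣ, pfree L₀ = PowerSeries.C (u : ℤ_[p]) * L₁ := by
  -- `c' ≠ 0`
  have hc' : c' ≠ 0 := by
    rintro rfl
    apply h₁
    have : L₁ = 0 := iwasawaToPowerSeries_injective p (by rw [hι₁, map_zero, zero_mul, map_zero])
    rw [this]; unfold red; rw [map_zero]
  -- a unit coefficient of `L₁`
  obtain ⟨k, hk⟩ := exists_isUnit_coeff_of_red_ne_zero h₁
  set u₁ : ℤ_[p]ˣ := hk.unit with hu₁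
  have hu₁v : (u₁ : ℤ_[p]) = PowerSeries.coeff k L₁ := hk.unit_spec
  -- coefficientwise: `(L₀)_j = d · (L₁)_j` with `d = c / c'`
  have hcoef : ∀ j : ℕ, ((PowerSeries.coeff j L₀ : ℤ_[p]) : ℚ_[p]) =
      c / c' * ((PowerSeries.coeff j L₁ : ℤ_[p]) : ℚ_[p]) := by
    intro j
    have h0 := congrArg (PowerSeries.coeff j) hι₀
    have h1 := congrArg (PowerSeries.coeff j) hι₁
    simp only [PowerSeries.coeff_map, PowerSeries.coeff_C_mul] at h0 h1
    rw [show (algebraMap ℤ_[p] ℚ_[p]) (PowerSeries.coeff j L₀) = ((PowerSeries.coeff j L₀ : ℤ_[p]) : ℚ_[p])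
      from rfl] at h0
    rw [show (algebraMap ℤ_[p] ℚ_[p]) (PowerSeries.coeff j L₁) = ((PowerSeries.coeff j L₁ : ℤ_[p]) : ℚ_[p])
      from rfl] at h1
    rw [h0, h1]
    field_simp
  -- `d ∈ ℤ_p`: `d = (L₀)_k · u₁⁻¹`
  set d₀ : ℤ_[p] := PowerSeries.coeff k L₀ * ((u₁⁻¹ : ℤ_[p]ˣ) : ℤ_[p]) with hd₀
  have hd₀c : ((d₀ : ℤ_[p]) : ℚ_[p]) = c / c' := by
    have hk' := hcoef k
    have hu₁q : ((PowerSeries.coeff k L₁ : ℤ_[p]) : ℚ_[p]) ≠ 0 := by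
      rw [← hu₁v]
      exact mt PadicInt.coe_eq_zero.mp (Units.ne_zero u₁)
    rw [hd₀, PadicInt.coe_mul, hk', ← hu₁v, mul_assoc, ← PadicInt.coe_mul, Units.mul_inv, PadicInt.coe_one, mul_one]
  -- `L₀ = C d₀ * L₁`
  have hL₀ : L₀ = PowerSeries.C d₀ * L₁ := by
    apply iwasawaToPowerSeries_injective p
    ext j
    simp only [map_mul, PowerSeries.coeff_map, PowerSeries.map_C, PowerSeries.coeff_C_mul]
    change ((PowerSeries.coeff j L₀ : ℤ_[p]) : ℚ_[p]) = ((d₀ : ℤ_[p]) : ℚ_[p]) * ((PowerSeries.coeff j L₁ : ℤ_[p]) : ℚ_[p])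
    rw [hd₀c, hcoef j]
  have hd₀0 : d₀ ≠ 0 := by
    rintro h
    exact h₀ (by rw [hL₀, h, map_zero, zero_mul])
  -- `d₀ = u · p^v`
  have hspec := PadicInt.unitCoeff_spec hd₀0
  set u := PadicInt.unitCoeff hd₀0 with hu
  refine ⟨u, ?_⟩
  have hfac : L₀ = PowerSeries.C ((p : ℤ_[p]) ^ d₀.valuation) * (PowerSeries.C (u : ℤ_[p]) * L₁) := by
    rw [hL₀]
    nth_rw 1 [hspec]
    rw [map_mul]; ring
  have hred : red (PowerSeries.C (u : ℤ_[p]) * L₁) ≠ 0 := by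
    intro h
    have hk0 := congrArg (PowerSeries.coeff k) h
    simp only [red, map_mul, PowerSeries.map_C, PowerSeries.coeff_C_mul, PowerSeries.coeff_map, map_zero] at hk0
    rcases mul_eq_zero.mp hk0 with h' | h'
    · exact (IsLocalRing.residue_ne_zero_iff_isUnit _ |>.mpr (Units.isUnit u)) h'
    · exact (IsLocalRing.residue_ne_zero_iff_isUnit _ |>.mpr hk) h'
  exact (mu_eq_and_pfree_eq hred hfac).2

/-- The residue of a unit of `ℤ₂` is `1` (`𝔽₂` has one unit). [folklore] -/
theorem residue_units_eq_one_two (u : ℤ_[2]ˣ) : IsLocalRing.residue ℤ_[2] (u : ℤ_[2]) = 1 := by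
  have hsub : (u : ℤ_[2]) - 1 ∈ IsLocalRing.maximalIdeal ℤ_[2] := by
    rw [← PadicInt.ker_toZMod, RingHom.mem_ker, map_sub, map_one]
    have hunit : IsUnit (PadicInt.toZMod (p := 2) (u : ℤ_[2])) := (Units.isUnit u).map _
    have h1 : ∀ x : ZMod 2, IsUnit x → x = 1 := by decide
    rw [h1 _ hunit, sub_self]
  rw [← sub_eq_zero, ← map_one (IsLocalRing.residue ℤ_[2]), ← map_sub]
  exact (IsLocalRing.residue_eq_zero_iff _).mpr hsub

/-- **At `p = 2` the primitive-scale transfer is literal**: `red(pfree L₀) = red L₁`. [cite: Washington1997, §7.1] -/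
theorem red_pfree_eq_red_two {L₀ L₁ : IwasawaAlgebra 2} {c c' : ℚ_[2]} {X : PowerSeries ℚ_[2]}
    (h₀ : L₀ ≠ 0) (hι₀ : iwasawaToPowerSeries 2 L₀ = PowerSeries.C c * X)
    (hι₁ : iwasawaToPowerSeries 2 L₁ = PowerSeries.C c' * X) (h₁ : red L₁ ≠ 0) :
    red (pfree L₀) = red L₁ := by
  obtain ⟨u, hu⟩ := exists_units_pfree_eq_C_mul h₀ hι₀ hι₁ h₁
  rw [hu]; unfold red
  rw [map_mul, PowerSeries.map_C, residue_units_eq_one_two, map_one, one_mul]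

end Lambda

/-! ## §2. Riemann sums at `p = 2`: the two `η`-halves -/

section RiemannTwo

/-- The `2`-adic roots of unity of order dividing `2` are `±1`. [folklore] -/
private theorem coe_rootsOfUnity_two_eq_or' (ξ : rootsOfUnity 2 ℤ_[2]) :
    ((ξ : ℤ_[2]ˣ) : ℤ_[2]) = 1 ∨ ((ξ : ℤ_[2]ˣ) : ℤ_[2]) = -1 := by
  have h := ξ.2
  rw [mem_rootsOfUnity] at h
  have h' : (((ξ : ℤ_[2]ˣ) : ℤ_[2])) ^ 2 = 1 := by
    rw [← Units.val_pow_eq_pow_val, h, Units.val_one]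
  exact sq_eq_one_iff.mp h'

/-- **The Riemann sums at `p = 2` split into the two `η`-halves** (`ℤ₂^× = {±1}·(1 + 4ℤ₂)`, `γ = 5`):
`RS_μ(k, n) = Σ_s μ(5ˢ + 2ⁿ⁺²ℤ₂)·C(s,k) + Σ_s μ(−5ˢ + 2ⁿ⁺²ℤ₂)·C(s,k)`. [cite: MazurTateTeitelbaum1986Invent, §I.13] -/
theorem distributionRiemannSum_two_eq_add (μ : (n : ℕ) → ZMod (2 ^ n) → ℚ_[2]) (k n : ℕ) :
    distributionRiemannSum μ k n =
      (∑ s : ZMod (2 ^ n), μ (n + 2) ((cyclotomicGenerator 2 : ZMod (2 ^ (n + 2))) ^ s.val) *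
          (s.val.choose k : ℚ_[2])) +
      ∑ s : ZMod (2 ^ n), μ (n + 2) (-((cyclotomicGenerator 2 : ZMod (2 ^ (n + 2))) ^ s.val)) *
          (s.val.choose k : ℚ_[2]) := by
  classical
  set G : ℤ_[2] → ℚ_[2] := fun u ↦ ∑ s : ZMod (2 ^ n),
    μ (n + 2) (PadicInt.toZModPow (n + 2) u *
        (cyclotomicGenerator 2 : ZMod (2 ^ (n + 2))) ^ s.val) * (s.val.choose k : ℚ_[2]) with hG
  have hG1 : G 1 = ∑ s : ZMod (2 ^ n),
      μ (n + 2) ((cyclotomicGenerator 2 : ZMod (2 ^ (n + 2))) ^ s.val) * (s.val.choose k : ℚ_[2]) := by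
    simp only [hG, map_one, one_mul]
  have hGneg : G (-1) = ∑ s : ZMod (2 ^ n),
      μ (n + 2) (-((cyclotomicGenerator 2 : ZMod (2 ^ (n + 2))) ^ s.val)) * (s.val.choose k : ℚ_[2]) := by
    simp only [hG, map_neg, map_one, neg_one_mul]
  have hζmem : (-1 : ℤ_[2]ˣ) ∈ rootsOfUnity 2 ℤ_[2] := by
    rw [mem_rootsOfUnity]; norm_num
  set ζ : rootsOfUnity 2 ℤ_[2] := ⟨-1, hζmem⟩ with hζ
  have hne : (1 : rootsOfUnity 2 ℤ_[2]) ≠ ζ := by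
    intro h
    have h' : (((1 : rootsOfUnity 2 ℤ_[2]) : ℤ_[2]ˣ) : ℤ_[2]) = ((ζ : ℤ_[2]ˣ) : ℤ_[2]) := by rw [h]
    rw [hζ] at h'
    simp only [OneMemClass.coe_one, Units.val_one, Units.val_neg] at h'
    have h2 : (2 : ℤ_[2]) = 0 := by linear_combination h'
    exact two_ne_zero h2
  haveI : Fintype (rootsOfUnity 2 ℤ_[2]) := Fintype.ofFinite _
  have huniv : (Finset.univ : Finset (rootsOfUnity 2 ℤ_[2])) = {1, ζ} := by
    ext ξ
    simp only [Finset.mem_univ, Finset.mem_insert, Finset.mem_singleton, true_iff]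
    rcases coe_rootsOfUnity_two_eq_or' ξ with h | h
    · left; exact Subtype.ext (Units.ext (by simpa using h))
    · right; exact Subtype.ext (Units.ext (by rw [hζ]; simpa using h))
  have hRS : distributionRiemannSum μ k n = ∑ᶠ ξ : rootsOfUnity (torsionOrder 2) ℤ_[2], G ((ξ : ℤ_[2]ˣ) : ℤ_[2]) := by
    rw [distributionRiemannSum]; rfl
  rw [hRS, torsionOrder_two, finsum_eq_sum_of_fintype, huniv, Finset.sum_pair hne]
  simp only [OneMemClass.coe_one, Units.val_one, hζ, Units.val_neg]
  rw [hG1, hGneg]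

/-- `5ˢ mod 2ⁿ⁺²` is `≡ 1 (mod 4)`. [folklore] -/
theorem val_cyclotomicGenerator_pow_mod_four (n s : ℕ) :
    ((cyclotomicGenerator 2 : ZMod (2 ^ (n + 2))) ^ s).val % 4 = 1 := by
  have h5 : (cyclotomicGenerator 2 : ZMod (2 ^ (n + 2))) ^ s = ((5 ^ s : ℕ) : ZMod (2 ^ (n + 2))) := by
    simp [cyclotomicGenerator, cyclotomicExponent]
  have h5s : ∀ t : ℕ, 5 ^ t % 4 = 1 := by
    intro t
    induction t with
    | zero => rfl
    | succ t ih => rw [pow_succ, Nat.mul_mod, ih]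
  rw [h5, ZMod.val_natCast, Nat.mod_mod_of_dvd _ (by rw [pow_add]; exact Dvd.intro_left _ rfl)]
  exact h5s s

/-- `−5ˢ mod 2ⁿ⁺²` is `≡ 3 (mod 4)`. [folklore] -/
theorem val_neg_cyclotomicGenerator_pow_mod_four (n s : ℕ) :
    (-((cyclotomicGenerator 2 : ZMod (2 ^ (n + 2))) ^ s)).val % 4 = 3 := by
  haveI : NeZero (2 ^ (n + 2)) := ⟨pow_ne_zero _ two_ne_zero⟩
  have h1 := val_cyclotomicGenerator_pow_mod_four n s
  set x := (cyclotomicGenerator 2 : ZMod (2 ^ (n + 2))) ^ s with hx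
  have hx0 : x ≠ 0 := by
    intro h; rw [h, ZMod.val_zero] at h1; norm_num at h1
  rw [ZMod.neg_val, if_neg hx0]
  have hlt : x.val < 2 ^ (n + 2) := ZMod.val_lt x
  have h4 : 4 ∣ 2 ^ (n + 2) := by rw [pow_add]; exact Dvd.intro_left _ rfl
  obtain ⟨q, hq⟩ := h4
  omega

end RiemannTwo

/-! ## §3. Small arithmetic helpers -/

section Helpers

/-- Sum over `ℤ/N` of a function of the representative in `[0, N)` is the sum over `range N`. [folklore] -/
theorem sum_zmod_val_eq_sum_range {M : Type*} [AddCommMonoid M] (N : ℕ) [NeZero N] (F : ℕ → M) :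
    ∑ s : ZMod N, F s.val = ∑ i ∈ Finset.range N, F i := by
  refine Finset.sum_nbij' (fun s ↦ s.val) (fun i ↦ (i : ZMod N)) ?_ ?_ ?_ ?_ ?_
  · intro s _; exact Finset.mem_range.mpr (ZMod.val_lt s)
  · intro i _; exact Finset.mem_univ _
  · intro s _; exact ZMod.natCast_zmod_val s
  · intro i hi; exact ZMod.val_natCast_of_lt (Finset.mem_range.mp hi)
  · intro s _; rfl

/-- Hockey stick: `Σ_{s < N} C(s, k) = C(N, k+1)`. [folklore] -/
theorem sum_range_choose_eq_choose_succ (N k : ℕ) :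
    ∑ s ∈ Finset.range N, s.choose k = N.choose (k + 1) := by
  induction N with
  | zero => simp
  | succ N ih => rw [Finset.sum_range_succ, ih, Nat.choose_succ_succ', add_comm]

/-- `(k+1)·C(2ⁿ, k+1) = 2ⁿ·C(2ⁿ−1, k)`. [folklore] -/
theorem choose_two_pow_succ_mul (n k : ℕ) : (2 ^ n).choose (k + 1) * (k + 1) = 2 ^ n * (2 ^ n - 1).choose k := by
  have h := Nat.add_one_mul_choose_eq (2 ^ n - 1) k
  have h1 : 2 ^ n - 1 + 1 = 2 ^ n := Nat.succ_pred_eq_of_pos (pow_pos two_pos n)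
  rw [h1] at h
  exact h.symm

/-- The same identity in `ℚ₂`. [folklore] -/
theorem cast_choose_two_pow_succ_mul (n k : ℕ) :
    (((2 ^ n).choose (k + 1) : ℕ) : ℚ_[2]) * ((k : ℚ_[2]) + 1) =
      (2 : ℚ_[2]) ^ n * (((2 ^ n - 1).choose k : ℕ) : ℚ_[2]) := by
  have h' := congrArg (fun m : ℕ ↦ (m : ℚ_[2])) (choose_two_pow_succ_mul n k)
  simp only [Nat.cast_mul, Nat.cast_pow, Nat.cast_add, Nat.cast_one, Nat.cast_ofNat] at h'
  exact h'

/-- `k + 1 ≠ 0` in `ℚ₂`. [folklore] -/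
theorem natCast_add_one_ne_zero_padic (k : ℕ) : (k : ℚ_[2]) + 1 ≠ 0 := by
  have : ((k + 1 : ℕ) : ℚ_[2]) ≠ 0 := Nat.cast_ne_zero.mpr (Nat.succ_ne_zero k)
  simpa using this

/-- `C(2ⁿ, k+1) = 2ⁿ·C(2ⁿ−1, k)/(k+1)` in `ℚ₂`. [folklore] -/
theorem cast_choose_two_pow_succ_eq (n k : ℕ) :
    (((2 ^ n).choose (k + 1) : ℕ) : ℚ_[2]) =
      (2 : ℚ_[2]) ^ n * (((2 ^ n - 1).choose k : ℕ) : ℚ_[2]) * ((k : ℚ_[2]) + 1)⁻¹ :=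
  (eq_mul_inv_iff_mul_eq₀ (natCast_add_one_ne_zero_padic k)).mpr (cast_choose_two_pow_succ_mul n k)

/-- A binomial coefficient has `2`-adic norm `≤ 1`. [folklore] -/
theorem norm_cast_choose_le_one (a b : ℕ) : ‖((a.choose b : ℕ) : ℚ_[2])‖ ≤ 1 := by
  have := Padic.norm_int_le_one (p := 2) ((a.choose b : ℕ) : ℤ)
  rwa [Int.cast_natCast] at this

/-- `‖2ⁿ · X · Y⁻¹‖₂ ≤ 2⁻ⁿ·‖Y‖⁻¹` for `‖X‖ ≤ 1`. [folklore] -/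
theorem norm_two_pow_mul_mul_inv_le (n : ℕ) (X Y : ℚ_[2]) (hc : ‖X‖ ≤ 1) :
    ‖(2 : ℚ_[2]) ^ n * X * Y⁻¹‖ ≤ (2 : ℝ)⁻¹ ^ n * ‖Y‖⁻¹ := by
  rw [norm_mul, norm_mul, norm_inv, norm_pow, TwoAdicTwistConverse.norm_two_padic_two]
  have h0 : 0 ≤ ‖Y‖⁻¹ := inv_nonneg.mpr (norm_nonneg _)
  calc (2 : ℝ)⁻¹ ^ n * ‖X‖ * ‖Y‖⁻¹ ≤ (2 : ℝ)⁻¹ ^ n * 1 * ‖Y‖⁻¹ := by gcongr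
    _ = _ := by rw [mul_one]

/-- `‖C(2ⁿ, k+1)‖₂ ≤ 2⁻ⁿ / ‖k+1‖₂`. [folklore] -/
theorem norm_choose_two_pow_succ_le (n k : ℕ) :
    ‖(((2 ^ n).choose (k + 1) : ℕ) : ℚ_[2])‖ ≤ (2 : ℝ)⁻¹ ^ n * ‖(k : ℚ_[2]) + 1‖⁻¹ := by
  have h := norm_two_pow_mul_mul_inv_le n _ ((k : ℚ_[2]) + 1) (norm_cast_choose_le_one (2 ^ n - 1) k)
  rwa [← cast_choose_two_pow_succ_eq n k] at h

/-- A unit of `ℤ₂` is `≡ 1 (mod 2)`: `‖w − 1‖₂ ≤ 1/2`. [folklore] -/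
theorem norm_units_sub_one_le_half (w : ℤ_[2]ˣ) : ‖((w : ℤ_[2]) : ℚ_[2]) - 1‖ ≤ (2 : ℝ)⁻¹ := by
  have hsub : (w : ℤ_[2]) - 1 ∈ IsLocalRing.maximalIdeal ℤ_[2] := by
    rw [← IsLocalRing.residue_eq_zero_iff, map_sub, map_one, residue_units_eq_one_two, sub_self]
  rw [PadicInt.maximalIdeal_eq_span_p, Ideal.mem_span_singleton] at hsub
  obtain ⟨y, hy⟩ := hsub
  have h : ((w : ℤ_[2]) : ℚ_[2]) - 1 = 2 * ((y : ℤ_[2]) : ℚ_[2]) := by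
    have := congrArg (fun z : ℤ_[2] ↦ (z : ℚ_[2])) hy
    push_cast at this
    exact this
  rw [h, norm_mul, TwoAdicTwistConverse.norm_two_padic_two]
  calc (2 : ℝ)⁻¹ * ‖((y : ℤ_[2]) : ℚ_[2])‖ ≤ 2⁻¹ * 1 := by gcongr; exact PadicInt.norm_le_one y
    _ = 2⁻¹ := mul_one _

/-- Integers congruent mod `2` are `2`-adically close: `‖n − n'‖₂ ≤ 1/2`. [folklore] -/
theorem norm_intCast_sub_le_half_of_zmod_eq {n n' : ℤ} (h : (n : ZMod 2) = (n' : ZMod 2)) :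
    ‖((n : ℚ_[2]) - (n' : ℚ_[2]))‖ ≤ (2 : ℝ)⁻¹ := by
  have hdvd : (2 : ℤ) ∣ n - n' := by
    have := (ZMod.intCast_eq_intCast_iff_dvd_sub n' n 2).mp h.symm
    exact_mod_cast this
  obtain ⟨e, he⟩ := hdvd
  have hcast : ((n : ℚ_[2]) - (n' : ℚ_[2])) = 2 * (e : ℚ_[2]) := by exact_mod_cast he
  rw [hcast, norm_mul, TwoAdicTwistConverse.norm_two_padic_two]
  calc (2 : ℝ)⁻¹ * ‖(e : ℚ_[2])‖ ≤ 2⁻¹ * 1 := by gcongr; exact Padic.norm_int_le_one e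
    _ = 2⁻¹ := mul_one _

variable {W : WeierstrassCurve ℚ} [W.IsGloballyMinimal]

/-- The unit root at `2` is a `2`-adic unit: its inverse powers are `≡ 1 (mod 2)`. [cite: MazurTateTeitelbaum1986Invent, §I.11] -/
theorem norm_unitRoot_inv_pow_sub_one_le_half (hord : IsOrdinaryAt W 2) (j : ℕ) :
    ‖((unitRoot W 2 : ℤ_[2]) : ℚ_[2])⁻¹ ^ j - 1‖ ≤ (2 : ℝ)⁻¹ := by
  obtain ⟨-, hu⟩ := unitRoot_spec_holds W 2 hord
  set u : ℤ_[2]ˣ := hu.unit with hudef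
  have huv : (u : ℤ_[2]) = unitRoot W 2 := hu.unit_spec
  have hinv : ((unitRoot W 2 : ℤ_[2]) : ℚ_[2])⁻¹ = (((u⁻¹ : ℤ_[2]ˣ) : ℤ_[2]) : ℚ_[2]) := by
    rw [← huv]
    refine (eq_inv_of_mul_eq_one_left ?_).symm
    rw [← PadicInt.coe_mul, Units.inv_mul, PadicInt.coe_one]
  rw [hinv, ← PadicInt.coe_pow, ← Units.val_pow_eq_pow_val]
  exact norm_units_sub_one_le_half _

end Helpers

end Summit.BirchSwinnertonDyer.BirchSwinnertonDyer.Theorems.DepletionAtTwo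

end
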